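import Literature.AnabelianGeometry.SemiGraphs.TemperedDLocTransport

/-!
# Thm. 6.8 (ii) of [SemiAnbd]: the equivalence `DLoc_{G_K}(Π^temp_{X_K}) ≌ DLoc_{G_L}(Π^temp_{Y_L})` induced by `α`, reduced to Thm. 6.5 (iii)

Mochizuki, *Semi-graphs of anabelioids*, Publ. RIMS **42** (2006) [SemiAnbd], §6, Theorem 6.8
(ii), author's manuscript p. 74: "Every isomorphism of tempered groups `α : Π^temp_{X_K} ⥲ Π^temp_{Y_L}`
induces an equivalence of categories `DLoc_{G_K}(Π^temp_{X_K}) ⥲ DLoc_{G_L}(Π^temp_{Y_L})`".  Proof in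
print (p. 75): "In light of Theorems 6.4, 6.5, the present Theorem 6.8 follows by exactly the same
arguments as those applied in [Mzk8] to prove [Mzk8], Theorem 2.3", and [Mzk8] (Galois sections),
proof of Thm. 2.3 (ii): "assertion (ii) follows, in light of Proposition 1.1, (ii); Theorem 1.3,
(iii), formally from the definition of the categories". [cite: MochizukiSemiAnbd2006, Thm 6.8(ii) p.74]

This proof-side file (cell abc-iut, layer L3, seat abc-iut-L3-t4 gen 3) completes the formal
argument begun in `TemperedDLocTransport.lean`: with `F_α` the transport functor along `α` and
`F_{α⁻¹}` the one along `α⁻¹`, the isomorphisms `J ⥲ α(H)/α(N) ⥲ α⁻¹α(H)/α⁻¹α(N)` give natural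
isomorphisms `𝟭 ≅ F_α ⋙ F_{α⁻¹}` and `F_{α⁻¹} ⋙ F_α ≅ 𝟭`, whence the EQUIVALENCE
`DLocObj.transportEquivalence`, whose functor is `(H, N) ↦ (α(H), α(N))` on the nose.  Consequently
the typed equivalence clause `TemperedCurve.IsoInducesDLocEquivalence X Y DX.toDLocContext
DY.toDLocContext α` of Thm. 6.8 (ii) holds for every pair of genuine-morphism contexts
(`TemperedDLocCategory.lean`) as soon as (hΔ) `α(Δ^temp_X) = Δ^temp_Y` and `α`, `α⁻¹` preserve
cuspidal geometric decomposition groups — the latter is exactly [SemiAnbd] Thm. 6.5 (iii) as typed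
(`TemperedCurve.IsoPreservesCuspidalDecomp X Y` and `… Y X`): `isoInducesDLocEquivalence_of_thm65iii`.
At the level of the origin bundles: `TemperedOrigin.CuspidalAbsolutenessHolds Ω` gives the clause for
all certified curves and every `α` satisfying (hΔ) (`TemperedMorphismOrigin.dlocEquivalenceClause_of`).
(hΔ) — "isomorphisms of (tempered) arithmetic fundamental groups preserve the geometric subgroup",
[AbsAnab] Lem. 1.3.8 in the profinite case, used by [EtTh] §1 for tempered groups — is kept as an
explicit hypothesis.  The remaining printed content of Thm. 6.8 (ii) (the equivalence
`DLoc_K(X_K) ⥲ DLoc_L(Y_L)` "by applying the equivalences of (i)", functoriality in `α` up to unique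
isomorphism, preservation of decomposition groups of tempered `DLoc`-type) is not addressed here.
Typed ≠ endorsed; nothing here takes a side on [IUTchIII] Cor. 3.12.
-/

noncomputable section

namespace Literature.AnabelianGeometry.SemiGraphs

open scoped Pointwise
open CategoryTheory Topology

variable {p : ℕ} [Fact p.Prime]

namespace DLocObj

variable {X Y : TemperedCurve p} (α : X.PiTemp ≃ₜ* Y.PiTemp)
  (hΔ : X.DeltaTemp.map α.toMulEquiv.toMonoidHom = Y.DeltaTemp)
  (hI : ∀ I : Subgroup X.PiTemp, X.IsCuspidalGeometricDecompositionGroup I ↔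
    Y.IsCuspidalGeometricDecompositionGroup (I.map α.toMulEquiv.toMonoidHom))

/-! ### The hypotheses for `α⁻¹` -/

/-- `α⁻¹(α(I)) = I`. [cite: MochizukiSemiAnbd2006, Thm 6.8(ii) p.74] -/
theorem map_map_symm (I : Subgroup X.PiTemp) :
    (I.map α.toMulEquiv.toMonoidHom).map α.symm.toMulEquiv.toMonoidHom = I := by
  rw [Subgroup.map_map]
  convert Subgroup.map_id I
  ext x
  exact α.symm_apply_apply x

/-- `α(α⁻¹(I)) = I`. [cite: MochizukiSemiAnbd2006, Thm 6.8(ii) p.74] -/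
theorem map_symm_map (I : Subgroup Y.PiTemp) :
    (I.map α.symm.toMulEquiv.toMonoidHom).map α.toMulEquiv.toMonoidHom = I := by
  rw [Subgroup.map_map]
  convert Subgroup.map_id I
  ext x
  exact α.apply_symm_apply x

include hI in
/-- (hI) forwards. [cite: MochizukiSemiAnbd2006, Thm 6.8(ii) p.74] -/
theorem hI_mp : ∀ I : Subgroup X.PiTemp, X.IsCuspidalGeometricDecompositionGroup I →
    Y.IsCuspidalGeometricDecompositionGroup (I.map α.toMulEquiv.toMonoidHom) :=
  fun I h => (hI I).1 h

include hI in
/-- (hI) for `α⁻¹`. [cite: MochizukiSemiAnbd2006, Thm 6.8(ii) p.74] -/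
theorem hI_symm : ∀ I : Subgroup Y.PiTemp, Y.IsCuspidalGeometricDecompositionGroup I →
    X.IsCuspidalGeometricDecompositionGroup (I.map α.symm.toMulEquiv.toMonoidHom) := by
  intro I h
  apply (hI _).2
  rwa [map_symm_map]

include hΔ in
/-- (hΔ) for `α⁻¹`. [cite: MochizukiSemiAnbd2006, Thm 6.8(ii) p.74] -/
theorem hΔ_symm : Y.DeltaTemp.map α.symm.toMulEquiv.toMonoidHom = X.DeltaTemp := by
  rw [← hΔ, map_map_symm]

/-! ### The round trips `J ⥲ α(H)/α(N) ⥲ α⁻¹α(H)/α⁻¹α(N)` lie over `G_K` -/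

/-- The composite isomorphism `J ⥲ α⁻¹α(J)` of an object of `DLoc_{G_K}(Π^temp_{X_K})` lies over
`G_K`. [cite: MochizukiSemiAnbd2006, Thm 6.8(ii) p.74] -/
theorem augJ_roundtrip (A : DLocObj X) (j : A.J) :
    ((A.transport α (hI_mp α hI) hΔ).transport α.symm (hI_symm α hI) (hΔ_symm α hΔ)).augJ
      (((jIso α (hI_mp α hI) hΔ A).trans
        (jIso α.symm (hI_symm α hI) (hΔ_symm α hΔ) (A.transport α (hI_mp α hI) hΔ))) j) =
      A.augJ j := by
  induction j using QuotientGroup.induction_on with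
  | H h =>
    change X.aug (α.symm (α (h : X.PiTemp))) = X.aug (h : X.PiTemp)
    rw [α.symm_apply_apply]

/-- The composite isomorphism `J ⥲ αα⁻¹(J)` of an object of `DLoc_{G_L}(Π^temp_{Y_L})` lies over
`G_L`. [cite: MochizukiSemiAnbd2006, Thm 6.8(ii) p.74] -/
theorem augJ_roundtrip_symm (B : DLocObj Y) (j : B.J) :
    ((B.transport α.symm (hI_symm α hI) (hΔ_symm α hΔ)).transport α (hI_mp α hI) hΔ).augJ
      (((jIso α.symm (hI_symm α hI) (hΔ_symm α hΔ) B).trans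
        (jIso α (hI_mp α hI) hΔ (B.transport α.symm (hI_symm α hI) (hΔ_symm α hΔ)))) j) =
      B.augJ j := by
  induction j using QuotientGroup.induction_on with
  | H h =>
    change Y.aug (α (α.symm (h : Y.PiTemp))) = Y.aug (h : Y.PiTemp)
    rw [α.apply_symm_apply]

/-- `J → α(J) → α⁻¹α(J)` followed by the inverse isomorphisms is the identity.
[cite: MochizukiSemiAnbd2006, Thm 6.8(ii) p.74] -/
theorem roundtrip_symm_apply (A : DLocObj X) (j : A.J) :
    (jIso α (hI_mp α hI) hΔ A).symm
      ((jIso α.symm (hI_symm α hI) (hΔ_symm α hΔ) (A.transport α (hI_mp α hI) hΔ)).symm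
        ((jIso α.symm (hI_symm α hI) (hΔ_symm α hΔ) (A.transport α (hI_mp α hI) hΔ))
          (jIso α (hI_mp α hI) hΔ A j))) = j := by
  rw [ContinuousMulEquiv.symm_apply_apply, ContinuousMulEquiv.symm_apply_apply]

/-- `J → α⁻¹(J) → αα⁻¹(J)` followed by the inverse isomorphisms is the identity.
[cite: MochizukiSemiAnbd2006, Thm 6.8(ii) p.74] -/
theorem roundtrip_symm_apply' (B : DLocObj Y) (j : B.J) :
    (jIso α.symm (hI_symm α hI) (hΔ_symm α hΔ) B).symm
      ((jIso α (hI_mp α hI) hΔ (B.transport α.symm (hI_symm α hI) (hΔ_symm α hΔ))).symm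
        ((jIso α (hI_mp α hI) hΔ (B.transport α.symm (hI_symm α hI) (hΔ_symm α hΔ)))
          (jIso α.symm (hI_symm α hI) (hΔ_symm α hΔ) B j))) = j := by
  rw [ContinuousMulEquiv.symm_apply_apply, ContinuousMulEquiv.symm_apply_apply]

/-! ### The equivalence -/

/-- The unit `𝟭 ≅ F_α ⋙ F_{α⁻¹}`. [cite: MochizukiSemiAnbd2006, Thm 6.8(ii) p.74] -/
def transportUnitIso :
    letI := dlocCategory X; letI := dlocCategory Y
    𝟭 (DLocObj X) ≅ transportFunctor α (hI_mp α hI) hΔ ⋙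
      transportFunctor α.symm (hI_symm α hI) (hΔ_symm α hΔ) :=
  letI := dlocCategory X; letI := dlocCategory Y
  NatIso.ofComponents
    (fun A => isoOfEquiv ((jIso α (hI_mp α hI) hΔ A).trans
      (jIso α.symm (hI_symm α hI) (hΔ_symm α hΔ) (A.transport α (hI_mp α hI) hΔ)))
      (augJ_roundtrip α hΔ hI A))
    (by
      rintro A B ⟨φ⟩
      refine Quotient.sound ⟨1, fun j => ?_⟩
      rw [one_mul, inv_one, mul_one]
      exact congr_arg (fun y => jIso α.symm (hI_symm α hI) (hΔ_symm α hΔ)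
        (B.transport α (hI_mp α hI) hΔ) (jIso α (hI_mp α hI) hΔ B (φ.toHom y)))
        (roundtrip_symm_apply α hΔ hI A j))

/-- The counit `F_{α⁻¹} ⋙ F_α ≅ 𝟭`. [cite: MochizukiSemiAnbd2006, Thm 6.8(ii) p.74] -/
def transportCounitIso :
    letI := dlocCategory X; letI := dlocCategory Y
    transportFunctor α.symm (hI_symm α hI) (hΔ_symm α hΔ) ⋙ transportFunctor α (hI_mp α hI) hΔ ≅
      𝟭 (DLocObj Y) :=
  letI := dlocCategory X; letI := dlocCategory Y
  NatIso.ofComponents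
    (fun B => (isoOfEquiv ((jIso α.symm (hI_symm α hI) (hΔ_symm α hΔ) B).trans
      (jIso α (hI_mp α hI) hΔ (B.transport α.symm (hI_symm α hI) (hΔ_symm α hΔ))))
      (augJ_roundtrip_symm α hΔ hI B)).symm)
    (by
      rintro A B ⟨φ⟩
      refine Quotient.sound ⟨1, fun j => ?_⟩
      rw [one_mul, inv_one, mul_one]
      exact (roundtrip_symm_apply' α hΔ hI B (φ.toHom
        ((jIso α.symm (hI_symm α hI) (hΔ_symm α hΔ) A).symm
          ((jIso α (hI_mp α hI) hΔ (A.transport α.symm (hI_symm α hI) (hΔ_symm α hΔ))).symm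
            j)))).symm)

/-- **The equivalence `DLoc_{G_K}(Π^temp_{X_K}) ≌ DLoc_{G_L}(Π^temp_{Y_L})` induced by `α`** (Thm. 6.8
(ii)), under (hΔ) and (hI); its functor is `(H ↠ H/N) ↦ (α(H) ↠ α(H)/α(N))`.
[cite: MochizukiSemiAnbd2006, Thm 6.8(ii) p.74] -/
def transportEquivalence :
    letI := dlocCategory X; letI := dlocCategory Y; DLocObj X ≌ DLocObj Y :=
  letI := dlocCategory X; letI := dlocCategory Y
  CategoryTheory.Equivalence.mk (transportFunctor α (hI_mp α hI) hΔ)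
    (transportFunctor α.symm (hI_symm α hI) (hΔ_symm α hΔ)) (transportUnitIso α hΔ hI)
    (transportCounitIso α hΔ hI)

/-- The functor of the transport equivalence acts on `H` by `α`.
[cite: MochizukiSemiAnbd2006, Thm 6.8(ii) p.74] -/
theorem transportEquivalence_functor_obj_H (A : DLocObj X) :
    letI := dlocCategory X; letI := dlocCategory Y
    ((transportEquivalence α hΔ hI).functor.obj A).H = A.H.map α.toMulEquiv.toMonoidHom := rfl

/-- The functor of the transport equivalence acts on `N` by `α`.
[cite: MochizukiSemiAnbd2006, Thm 6.8(ii) p.74] -/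
theorem transportEquivalence_functor_obj_N (A : DLocObj X) :
    letI := dlocCategory X; letI := dlocCategory Y
    ((transportEquivalence α hΔ hI).functor.obj A).N = A.N.map α.toMulEquiv.toMonoidHom := rfl

end DLocObj

/-! ### Theorem 6.8 (ii), equivalence clause, for genuine-morphism contexts -/

/-- **[SemiAnbd] Thm. 6.8 (ii), equivalence clause, PROVED modulo (hΔ) and (hI)**: for any
genuine-morphism contexts `DX`, `DY` (`DLocSchemeData`), an isomorphism `α : Π^temp_{X_K} ⥲ Π^temp_{Y_L}`
with `α(Δ^temp_X) = Δ^temp_Y` which, together with `α⁻¹`, preserves cuspidal geometric decomposition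
groups induces an equivalence `DLoc_{G_K}(Π^temp_{X_K}) ≌ DLoc_{G_L}(Π^temp_{Y_L})` transporting `(H, N)`
along `α` — the typed `TemperedCurve.IsoInducesDLocEquivalence`.
[cite: MochizukiSemiAnbd2006, Thm 6.8(ii) p.74] -/
theorem isoInducesDLocEquivalence_of {X Y : TemperedCurve p} (DX : DLocSchemeData X)
    (DY : DLocSchemeData Y) (α : X.PiTemp ≃ₜ* Y.PiTemp)
    (hΔ : X.DeltaTemp.map α.toMulEquiv.toMonoidHom = Y.DeltaTemp)
    (hI : ∀ I : Subgroup X.PiTemp, X.IsCuspidalGeometricDecompositionGroup I ↔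
      Y.IsCuspidalGeometricDecompositionGroup (I.map α.toMulEquiv.toMonoidHom)) :
    X.IsoInducesDLocEquivalence Y DX.toDLocContext DY.toDLocContext α :=
  ⟨DLocObj.transportEquivalence α hΔ hI, fun _ => ⟨rfl, rfl⟩⟩

/-- **[SemiAnbd] Thm. 6.8 (ii), equivalence clause ⟸ Thm. 6.5 (iii) + (hΔ)**: if isomorphisms of
tempered groups between `Π^temp_{X_K}` and `Π^temp_{Y_L}` preserve cuspidal geometric decomposition
groups in both directions ([SemiAnbd] Thm. 6.5 (iii) as typed, `IsoPreservesCuspidalDecomp`), then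
every `α` with `α(Δ^temp_X) = Δ^temp_Y` induces the equivalence of Thm. 6.8 (ii) (genuine morphisms).
[cite: MochizukiSemiAnbd2006, Thm 6.8(ii) p.74] -/
theorem isoInducesDLocEquivalence_of_thm65iii {X Y : TemperedCurve p} (DX : DLocSchemeData X)
    (DY : DLocSchemeData Y) (h65 : X.IsoPreservesCuspidalDecomp Y)
    (h65' : Y.IsoPreservesCuspidalDecomp X) (α : X.PiTemp ≃ₜ* Y.PiTemp)
    (hΔ : X.DeltaTemp.map α.toMulEquiv.toMonoidHom = Y.DeltaTemp) :
    X.IsoInducesDLocEquivalence Y DX.toDLocContext DY.toDLocContext α := by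
  refine isoInducesDLocEquivalence_of DX DY α hΔ fun I => ⟨fun h => (h65 α I).2 h, fun h => ?_⟩
  have := (h65' α.symm (I.map α.toMulEquiv.toMonoidHom)).2 h
  rwa [DLocObj.map_map_symm] at this

namespace TemperedMorphismOrigin

/-- **Thm. 6.8 (ii), equivalence clause, over the origin hypotheses ⟸ Thm. 6.5 (iii) as printed**:
if `CuspidalAbsolutenessHolds Ω` ([SemiAnbd] Thm. 6.5 (iii) for all certified curves), then for all
certified `X_K`, `Y_L` with genuine-morphism `DLoc` data and every `α` with `α(Δ^temp_X) = Δ^temp_Y`,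
the equivalence `DLoc_{G_K}(Π^temp_{X_K}) ≌ DLoc_{G_L}(Π^temp_{Y_L})` of Thm. 6.8 (ii) exists.
[cite: MochizukiSemiAnbd2006, Thm 6.8(ii) p.74] -/
theorem dlocEquivalenceClause_of (Ω : TemperedMorphismOrigin p)
    (h65 : Ω.CuspidalAbsolutenessHolds) (X Y : TemperedCurve p) (DX : DLocSchemeData X)
    (DY : DLocSchemeData Y) (hX : Ω.IsHyperbolicCurveOrigin X) (hY : Ω.IsHyperbolicCurveOrigin Y)
    (α : X.PiTemp ≃ₜ* Y.PiTemp) (hΔ : X.DeltaTemp.map α.toMulEquiv.toMonoidHom = Y.DeltaTemp) :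
    X.IsoInducesDLocEquivalence Y DX.toDLocContext DY.toDLocContext α :=
  isoInducesDLocEquivalence_of_thm65iii DX DY (h65 X Y hX hY) (h65 Y X hY hX) α hΔ

end TemperedMorphismOrigin

end Literature.AnabelianGeometry.SemiGraphs

end
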